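import Summits.BirchSwinnertonDyer.Rank1Residual.Additive.WildThreeDeltaResidue
import Summits.BirchSwinnertonDyer.Rank1Residual.Additive.CondExpFourUnitPartLawThreeOfTableII
import Summits.BirchSwinnertonDyer.Rank1Residual.Additive.KodairaDictionaryThree
import Mathlib.NumberTheory.Padics.HeightOneSpectrum
import Mathlib.NumberTheory.Padics.RingHoms
import HarnessLib

/-!
# L-O6-cyc9 is a THEOREM: `f₃ = 4 ∧ v₃(Δ_min) ∈ {6, 12} ⟹ Δ′ ≢ ±1 (mod 9)` UNCONDITIONALLY, hence the
# cyclic wild rows never meet the Fouquet–Wan locus — `Additive.CondExpFourUnitPartLawThree` discharged,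
# the Table II binder of `CondExpFourUnitPartLawThreeOfTableII` retired (cell `b2b-bsdres`; seat
# `b2b-bsdres-x11b3-p7` GEN 7 as cross-cell pool hand; theorems only)

HONEST FRAMING (cell `b2b-bsdres`, run/shared/lean/b2b/bsd-rank1-residual/, verbatim in every file): the
goal of the cell is to DELETE the COMBINATION-SHAPED residual classes of the Birch–Swinnerton-Dyer formula
for ALL analytic-rank `≤ 1` elliptic curves over `ℚ` — "full BSD formula for every rank `≤ 1` curve in
class `C`" assembled STRICTLY from published theorems — so that the rank-`≤ 1` remainder becomes exactly
the CONSTRUCTION-SHAPED classes, which are TYPED (missing-input `Prop`s), NOT attempted. This is not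
"finishing BSD". Lane CLASS-CLOSURE / team o6 (O6 OPEN): research routes; census output is EVIDENCE,
never a Literature fact; nothing is booked; no mark of `RESIDUAL-MAP.md` moves. This file: THEOREMS ONLY
(no definition, no named fact, no `@[conjecture]` node, no `sorry`; net named-fact debt `0`); NO
hypothesis beyond the TARGET's own binders — no table, no named fact.

## What is proved

* §2 `kodairaSymbolAt_of_condExp_four` — additive at `3` with `f₃ = 4` and `v₃(Δ_min) ∈ {6, 12}` ⟹
  Kodaira `IV` with `v₃Δ_min = 6` or `II*` with `v₃Δ_min = 12` (the tame types have `f₃ = 2`,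
  `condExpTwo_three_of_kodairaSymbolAt_tame`; for the wild ones `f₃ = v₃Δ_min + 1 − m`).
* §3 **`not_isPmOneModNine_of_condExp_four (hadd : Addv W 3) (hf : condExp W 3 = 4)
  (hv : v₃Δ_min = 6 ∨ v₃Δ_min = 12) : ¬ IsPmOneModNine (minimalDiscUnitPartThree W)`**: the wild normal
  forms (`exists_variableChange_b_of_kodairaSymbolAt_wild`, bsd.S15) on a `ℚ₃`-model `N = C • E` feed the
  bracket lemma `valued_δ_residue_of_wild_shape` (`Additive/WildThreeDeltaResidue.lean`):
  `δ = −8β₄³ − 3β₆² + 9t` with `β₄, β₆ ∈ 𝒪^×`; the scaling `u` of `C` is a `3`-adic unit and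
  `Δ′ = u¹²δ` (`Δ(N) = u⁻¹²Δ_min`, `Δ_min = 3^v Δ′`); a residue map `𝒪_v →+* ℤ₃ →+* ℤ/9` (Mathlib
  `adicCompletion.padicEquiv`, `PadicInt.toZModPow 2`) then gives `Δ′ ≡ u¹²(−8a³ − 3b²) ≡ −8(±1) − 3
  ∈ {5, 7} (mod 9)` (`u⁶ = a⁶ = b⁶ = 1` in `(ℤ/9)^×`, `decide`).
* **`condExpFourUnitPartLawThree_holds : CondExpFourUnitPartLawThree`** (cc-typer-5's TARGET L-O6-cyc9
  in `Additive/LocIrrThreeCriteria.lean`, binders verbatim) and **`not_locIrr_three_of_cyclic_values'`**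
  — cc-typer-5's `not_locIrr_three_of_cyclic_values` with BOTH targets supplied as theorems
  (`locIrrThreeTameCube_holds`, this file): for `W` additive at `3` with `f₃ = 4`,
  `v₃(Δ_min) ∈ {4, 6, 10, 12}`, `¬ LocIrr W 3` — the cyclic wild cell is disjoint from the FW locus.

WORDING (EVIDENCE framing; cc-typer-5 / the o6 planners rule on `TYPED.md` / `TARGETS.md`): "L-O6-cyc9
`CondExpFourUnitPartLawThree` is a THEOREM (Tate's algorithm Steps 5/10 at `3` + the `4Δ` identity + a
residue map to `ℤ/9`); `condExpFourUnitPartLawThree_of_tableII` (p299644) stays as landed, superseded;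
censuses 1 833 / 1 833 and `LocIrr(3)` = 0 / 5 161 stay EVIDENCE; nothing booked; no mark."

References: J. H. Silverman, *Advanced Topics in the Arithmetic of Elliptic Curves*, GTM 151 (1994),
IV.9.4 Steps 5, 10, Table 4.1, IV.10–11 [SilvermanATAEC1994]; A. Kraus, Manuscripta Math. 69 (1990);
O. Rizzo, Compositio Math. 136 (2003), Table II (rows IV `(3,5,6)`, II* ★`(1,2,0)`) [Rizzo2003].
-/

noncomputable section

open scoped Classical

open WeierstrassCurve IsDedekindDomain IsDedekindDomain.HeightOneSpectrum WithZero Rat.HeightOneSpectrum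
  Literature.NumberTheory.EllipticCurves Literature.NumberTheory.EllipticCurves.Rank1Residual
  Literature.NumberTheory.EllipticCurves.Rank1Residual.Typed Literature.NumberTheory.DiophantineGeometry

namespace Summit.BirchSwinnertonDyer.Rank1Residual.Additive

/-! ## §2 `f₃ = 4 ∧ v₃(Δ_min) ∈ {6, 12}` ⟹ Kodaira `IV` (`v = 6`) or `II*` (`v = 12`) -/

section Curves

/-- The rational prime below `placeOf 3` is `3`. [folklore] -/
private theorem natGenerator_placeOf_three' : natGenerator (placeOf 3) = 3 :=
  Literature.NumberTheory.EllipticCurves.Rat.natGenerator_primesEquiv_symm ⟨3, Nat.prime_three⟩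

/-- `ord_{(3)}(3) = 1`. [folklore] -/
private theorem valuation_placeOf_three_three' :
    (placeOf 3).valuation ℚ (3 : ℚ) = exp (-1 : ℤ) := by
  rw [valuation_eq_exp_neg_padicValRat (placeOf 3) three_ne_zero, natGenerator_placeOf_three',
    show (3 : ℚ) = ((3 : ℕ) : ℚ) by norm_num, padicValRat.self (by norm_num)]

variable (W : WeierstrassCurve ℚ) [W.IsElliptic] [W.IsGloballyMinimal]

/-- **`Addv ∧ f₃ = 4 ∧ v₃(Δ_min) ∈ {6, 12}` ⟹ Kodaira `IV` with `v₃Δ_min = 6` or `II*` with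
`v₃Δ_min = 12`.** The tame types have `f₃ = 2`; among the wild ones `f₃ = v₃Δ_min + 1 − m` with
`m = 1, 3, 7, 9` for `II, IV, IV*, II*`, so `f₃ = 4` reads `v₃Δ_min = 4, 6, 10, 12` respectively.
[cite: SilvermanATAEC1994, IV Table 4.1 and IV.10 (Ogg's formula)] -/
theorem kodairaSymbolAt_of_condExp_four (hadd : Addv W 3) (hf : condExp W 3 = 4)
    (hv : padicValInt 3 W.minimalDiscriminantInt = 6 ∨ padicValInt 3 W.minimalDiscriminantInt = 12) :
    (W.kodairaSymbolAt (placeOf 3) = .IV ∧ padicValInt 3 W.minimalDiscriminantInt = 6) ∨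
      (W.kodairaSymbolAt (placeOf 3) = .IIstar ∧ padicValInt 3 W.minimalDiscriminantInt = 12) := by
  have hf' := hf
  unfold condExp conductorExponent numComponentsAt at hf'
  rw [ordMinimalDiscriminant_placeOf_eq W 3] at hf'
  rcases kodairaSymbolAt_three_cases_of_addv W hadd with ⟨n, hK⟩ | hK | hK | hK
  · exact absurd (condExpTwo_three_of_kodairaSymbolAt_tame W (Or.inr (Or.inr ⟨_, hK⟩))) (by
      unfold CondExpTwo; omega)
  · exact absurd (condExpTwo_three_of_kodairaSymbolAt_tame W (Or.inr (Or.inr ⟨_, hK⟩))) (by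
      unfold CondExpTwo; omega)
  · exact absurd (condExpTwo_three_of_kodairaSymbolAt_tame W (hK.elim Or.inl fun h ↦ Or.inr (Or.inl h)))
      (by unfold CondExpTwo; omega)
  · rcases hK with hK | hK | hK | hK <;> rw [hK] at hf' <;>
      simp only [KodairaSymbol.numComponents] at hf'
    · omega
    · exact Or.inl ⟨hK, by omega⟩
    · omega
    · exact Or.inr ⟨hK, by omega⟩

/-! ## §3 L-O6-cyc9 unconditionally: the residue of `Δ′` in `ℤ/9` -/

/-- Units of `ℤ/9` satisfy `x⁶ = 1` (`φ(9) = 6`). [folklore] -/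
private theorem pow_six_eq_one_of_isUnit {x : ZMod 9} (hx : IsUnit x) : x ^ 6 = 1 := by
  obtain ⟨w, rfl⟩ := hx
  have h := ZMod.pow_totient w
  have h9 : Nat.totient 9 = 6 := by
    rw [show (9 : ℕ) = 3 ^ 2 by norm_num, Nat.totient_prime_pow Nat.prime_three (by norm_num)]
    norm_num
  rw [h9] at h
  have h' := congrArg Units.val h
  simpa [Units.val_pow_eq_pow_val] using h'

/-- Cubes of units of `ℤ/9` are `±1`. [folklore] -/
private theorem zmod_nine_cube : ∀ a : ZMod 9, a ^ 6 = 1 → a ^ 3 = 1 ∨ a ^ 3 = 8 := by decide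

/-- `3u² = 3` for a unit `u` of `ℤ/9`. [folklore] -/
private theorem zmod_nine_three_mul_sq : ∀ b : ZMod 9, b ^ 6 = 1 → 3 * b ^ 2 = 3 := by decide

/-- `−8c − 3 ∉ {1, 8}` for `c = ±1` in `ℤ/9`. [folklore] -/
private theorem zmod_nine_final : ∀ c : ZMod 9, c = 1 ∨ c = 8 → -8 * c - 3 ≠ 1 ∧ -8 * c - 3 ≠ 8 := by
  decide

/-- The arithmetic kernel in `ℤ/9`: for units `a, b` (`a⁶ = b⁶ = 1`), `−8a³ − 3b² ∉ {1, 8}`.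
[folklore] -/
private theorem zmod_nine_key (a b : ZMod 9) (ha : a ^ 6 = 1) (hb : b ^ 6 = 1) :
    -8 * a ^ 3 - 3 * b ^ 2 ≠ 1 ∧ -8 * a ^ 3 - 3 * b ^ 2 ≠ 8 := by
  rw [show -8 * a ^ 3 - 3 * b ^ 2 = -8 * a ^ 3 - 3 by rw [zmod_nine_three_mul_sq b hb]]
  exact zmod_nine_final (a ^ 3) (zmod_nine_cube a ha)

/-- A unit of `𝒪_v` has valuation `1`. [folklore] -/
private theorem valued_eq_one_of_isUnit {x : (placeOf 3).adicCompletionIntegers ℚ} (hx : IsUnit x) :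
    Valued.v (x : (placeOf 3).adicCompletion ℚ) = 1 := by
  obtain ⟨y, hy⟩ := hx.exists_right_inv
  have h1 : Valued.v (x : (placeOf 3).adicCompletion ℚ) * Valued.v (y : (placeOf 3).adicCompletion ℚ) = 1 := by
    rw [← map_mul, ← Subring.coe_mul, hy]; simp
  refine le_antisymm x.2 ?_
  calc (1 : ℤᵐ⁰) = _ := h1.symm
    _ ≤ Valued.v (x : (placeOf 3).adicCompletion ℚ) * 1 := mul_le_mul' le_rfl y.2
    _ = _ := mul_one _

/-- In `ℤᵐ⁰`: `x ^ n = 1` with `n ≠ 0` forces `x = 1`. [folklore] -/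
private theorem eq_one_of_pow_eq_one' {x : ℤᵐ⁰} {n : ℕ} (hn : n ≠ 0) (h : x ^ n = 1) : x = 1 := by
  rcases lt_trichotomy x 1 with hlt | heq | hgt
  · exact absurd h (pow_lt_one' hlt hn).ne
  · exact heq
  · exact absurd h (one_lt_pow' hgt hn).ne'

/-- An element of `𝒪_v` of valuation `1` is a unit. [folklore] -/
private theorem isUnit_of_valued_eq_one {x : (placeOf 3).adicCompletionIntegers ℚ}
    (hx : Valued.v (x : (placeOf 3).adicCompletion ℚ) = 1) : IsUnit x := by
  have hx0 : (x : (placeOf 3).adicCompletion ℚ) ≠ 0 := fun h ↦ by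
    rw [h, map_zero] at hx; exact zero_ne_one hx
  let y : (placeOf 3).adicCompletionIntegers ℚ :=
    ⟨(x : (placeOf 3).adicCompletion ℚ)⁻¹, by
      rw [mem_adicCompletionIntegers, map_inv₀, hx, inv_one]⟩
  exact isUnit_iff_exists_inv.mpr ⟨y, Subtype.ext (mul_inv_cancel₀ hx0)⟩

/-- **L-O6-cyc9 per curve, UNCONDITIONALLY.** For `W/ℚ` elliptic and globally minimal, additive at `3`
with `f₃ = 4` and `v₃(Δ_min) ∈ {6, 12}`: `Δ′ ≢ ±1 (mod 9)`. Route: §2 gives the Kodaira type (IV /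
II*); the wild normal forms (`exists_variableChange_b_of_kodairaSymbolAt_wild`, bsd.S15) feed §1:
`δ = −8β₄³ − 3β₆² + 9t` on the `ℚ₃`-model with `β₄, β₆` units; the model's `u` is a `3`-adic unit
(`Δ′ = u¹²δ`), and the residue map `𝒪_v ≃ ℤ₃ → ℤ/9` (Mathlib `padicIntEquiv`, `PadicInt.toZModPow`)
lands in `zmod_nine_key`. No table, no named fact. [cite: SilvermanATAEC1994, IV.9.4 Steps 5, 10] -/
theorem not_isPmOneModNine_of_condExp_four (hadd : Addv W 3) (hf : condExp W 3 = 4)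
    (hv : padicValInt 3 W.minimalDiscriminantInt = 6 ∨ padicValInt 3 W.minimalDiscriminantInt = 12) :
    ¬ IsPmOneModNine (minimalDiscUnitPartThree W) := by
  haveI : PerfectField (IsLocalRing.ResidueField ((placeOf 3).adicCompletionIntegers ℚ)) :=
    PerfectField.ofFinite
  have h2 : ringChar (ℤ ⧸ (placeOf 3).asIdeal) ≠ 2 := by rw [ringChar_int_quot_placeOf 3]; decide
  have hπ := valuation_placeOf_three_three'
  have h3 : algebraMap ℚ ((placeOf 3).adicCompletion ℚ) 3 = 3 := map_ofNat _ 3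
  -- the unit part `Δ′` and `Δ_min = 3^v Δ′`, `3 ∤ Δ′`
  set D' := minimalDiscUnitPartThree W with hD'
  set vD := padicValInt 3 W.minimalDiscriminantInt with hvD
  have hDmin : W.minimalDiscriminantInt = 3 ^ vD * D' := minimalDiscriminantInt_eq_pow_mul_unitPart W
  have hD0 : W.minimalDiscriminantInt ≠ 0 := minimalDiscriminantInt_ne_zero W
  have hD'3 : ¬ (3 : ℤ) ∣ D' := by
    rintro ⟨d, hd⟩
    have h3 : (3 : ℤ) ^ (vD + 1) ∣ W.minimalDiscriminantInt := ⟨d, by rw [hDmin, hd]; ring⟩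
    rcases (padicValInt_dvd_iff (p := 3) _ _).mp (by exact_mod_cast h3) with h | h
    · exact hD0 h
    · omega
  -- Kodaira type and the shapes on a `ℚ₃`-model
  obtain ⟨e, hK, he⟩ : ∃ e : ℕ, ((W.kodairaSymbolAt (placeOf 3) = .IV ∧ e = 6) ∨
      (W.kodairaSymbolAt (placeOf 3) = .IIstar ∧ e = 12)) ∧
      padicValInt 3 W.minimalDiscriminantInt = e := by
    rcases kodairaSymbolAt_of_condExp_four W hadd hf hv with ⟨hK, h6⟩ | ⟨hK, h12⟩
    · exact ⟨6, Or.inl ⟨hK, rfl⟩, h6⟩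
    · exact ⟨12, Or.inr ⟨hK, rfl⟩, h12⟩
  have hve : vD = e := he
  have hord : W.ordMinimalDiscriminant (placeOf 3) = e := by
    rw [ordMinimalDiscriminant_placeOf_eq W 3]; exact he
  -- shapes on a `ℚ₃`-model and the residue identity of §1
  obtain ⟨C, β₄, β₆, δ, t, hβ₄, hβ₆, hδ, htw, hδeq, hΔN⟩ :
      ∃ (C : VariableChange ((placeOf 3).adicCompletion ℚ))
        (β₄ β₆ δ : (placeOf 3).adicCompletionIntegers ℚ) (t : (placeOf 3).adicCompletion ℚ),
        Valued.v (β₄ : (placeOf 3).adicCompletion ℚ) = 1 ∧ IsUnit β₆ ∧ IsUnit δ ∧ Valued.v t ≤ 1 ∧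
        (δ : (placeOf 3).adicCompletion ℚ) = -8 * (β₄ : (placeOf 3).adicCompletion ℚ) ^ 3 -
          algebraMap ℚ ((placeOf 3).adicCompletion ℚ) 3 * (β₆ : (placeOf 3).adicCompletion ℚ) ^ 2 +
          algebraMap ℚ ((placeOf 3).adicCompletion ℚ) 3 ^ 2 * t ∧
        (C • W.baseChange ((placeOf 3).adicCompletion ℚ)).Δ =
          algebraMap ℚ ((placeOf 3).adicCompletion ℚ) 3 ^ e * δ := by
    rcases hK with ⟨hK, rfl⟩ | ⟨hK, rfl⟩
    · obtain ⟨C, β₂, β₄, β₆, δ, hβ₆, hδ, hb₂, hb₄, hb₆, hΔ⟩ :=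
        W.exists_variableChange_b_of_kodairaSymbolAt_wild (placeOf 3) (k₂ := 1) (k₄ := 2) (k₆ := 2) h2
          (Or.inr (Or.inl ⟨hK, rfl, rfl, rfl⟩)) hπ
      rw [hord] at hΔ
      obtain ⟨hβ₄, t, htw, hδeq⟩ := valued_δ_residue_of_wild_shape (placeOf 3) hπ h3 _ β₂ β₄ β₆ δ
        hβ₆ hδ hb₂ hb₄ hb₆ hΔ (Or.inl ⟨rfl, rfl, rfl, rfl⟩)
      exact ⟨C, β₄, β₆, δ, t, hβ₄, hβ₆, hδ, htw, hδeq, hΔ⟩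
    · obtain ⟨C, β₂, β₄, β₆, δ, hβ₆, hδ, hb₂, hb₄, hb₆, hΔ⟩ :=
        W.exists_variableChange_b_of_kodairaSymbolAt_wild (placeOf 3) (k₂ := 2) (k₄ := 4) (k₆ := 5) h2
          (Or.inr (Or.inr (Or.inr ⟨hK, rfl, rfl, rfl⟩))) hπ
      rw [hord] at hΔ
      obtain ⟨hβ₄, t, htw, hδeq⟩ := valued_δ_residue_of_wild_shape (placeOf 3) hπ h3 _ β₂ β₄ β₆ δ
        hβ₆ hδ hb₂ hb₄ hb₆ hΔ (Or.inr ⟨rfl, rfl, rfl, rfl⟩)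
      exact ⟨C, β₄, β₆, δ, t, hβ₄, hβ₆, hδ, htw, hδeq, hΔ⟩
  rw [h3] at hδeq hΔN
  have h3v : Valued.v (algebraMap ℚ ((placeOf 3).adicCompletion ℚ) 3) = exp (-1 : ℤ) :=
    (valuedAdicCompletion_eq_valuation' (placeOf 3) (3 : ℚ)).trans hπ
  rw [h3] at h3v
  have h30 : (3 : (placeOf 3).adicCompletion ℚ) ≠ 0 := fun h ↦ by
    rw [h, map_zero] at h3v; exact exp_ne_zero h3v.symm
  -- `Δ′ = u¹² δ` with `u` the scaling of the model
  set u : (placeOf 3).adicCompletion ℚ := (C.u : (placeOf 3).adicCompletion ℚ) with hu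
  have hu0 : u ≠ 0 := C.u.ne_zero
  have hΔQ : W.Δ = (3 : ℚ) ^ e * (D' : ℚ) := by
    rw [← cast_minimalDiscriminantInt W, hDmin, hve]; push_cast; ring
  have hWΔ : (W.baseChange ((placeOf 3).adicCompletion ℚ)).Δ =
      (3 : (placeOf 3).adicCompletion ℚ) ^ e * ((D' : ℤ) : (placeOf 3).adicCompletion ℚ) := by
    rw [show (W.baseChange ((placeOf 3).adicCompletion ℚ)).Δ =
      algebraMap ℚ ((placeOf 3).adicCompletion ℚ) W.Δ from W.map_Δ _, hΔQ, map_mul, map_pow, h3,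
      map_intCast]
  have hD'eq : ((D' : ℤ) : (placeOf 3).adicCompletion ℚ) = u ^ 12 * (δ : (placeOf 3).adicCompletion ℚ) := by
    have hC := (W.baseChange ((placeOf 3).adicCompletion ℚ)).variableChange_Δ C
    rw [hΔN, hWΔ, Units.val_inv_eq_inv_val, ← hu] at hC
    have h3e : (3 : (placeOf 3).adicCompletion ℚ) ^ e ≠ 0 := pow_ne_zero _ h30
    have : (3 : (placeOf 3).adicCompletion ℚ) ^ e * (u ^ 12 * (δ : (placeOf 3).adicCompletion ℚ)) =
        (3 : (placeOf 3).adicCompletion ℚ) ^ e * ((D' : ℤ) : (placeOf 3).adicCompletion ℚ) := by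
      rw [show (3 : (placeOf 3).adicCompletion ℚ) ^ e * (u ^ 12 * (δ : (placeOf 3).adicCompletion ℚ)) =
        u ^ 12 * (3 ^ e * δ) by ring, hC]
      field_simp
    exact (mul_left_cancel₀ h3e this).symm
  -- `u` is a `3`-adic unit
  have hwD' : Valued.v ((D' : ℤ) : (placeOf 3).adicCompletion ℚ) = 1 := by
    have hD'0 : D' ≠ 0 := fun h ↦ hD'3 (h ▸ dvd_zero 3)
    have hQ0 : ((D' : ℤ) : ℚ) ≠ 0 := Int.cast_ne_zero.mpr hD'0
    have hcoe : Valued.v (algebraMap ℚ ((placeOf 3).adicCompletion ℚ) ((D' : ℤ) : ℚ)) =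
        (placeOf 3).valuation ℚ ((D' : ℤ) : ℚ) :=
      valuedAdicCompletion_eq_valuation' (placeOf 3) ((D' : ℤ) : ℚ)
    rw [valuation_eq_exp_neg_padicValRat (placeOf 3) hQ0, natGenerator_placeOf_three',
      padicValRat.of_int, padicValInt.eq_zero_of_not_dvd hD'3, map_intCast] at hcoe
    rw [hcoe]; simp
  have hwu : Valued.v u = 1 := by
    have hwδ := valued_eq_one_of_isUnit hδ
    have h := congrArg Valued.v hD'eq
    rw [hwD', map_mul, map_pow, hwδ, mul_one] at h
    exact eq_one_of_pow_eq_one' (by norm_num) h.symm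
  -- pass to `𝒪_v` and to `ℤ/9`
  let uO : (placeOf 3).adicCompletionIntegers ℚ := ⟨u, by rw [mem_adicCompletionIntegers]; exact hwu.le⟩
  let tO : (placeOf 3).adicCompletionIntegers ℚ := ⟨t, by rw [mem_adicCompletionIntegers]; exact htw⟩
  have huO : (uO : (placeOf 3).adicCompletion ℚ) = u := rfl
  have htO : (tO : (placeOf 3).adicCompletion ℚ) = t := rfl
  have hO : (((D' : ℤ) : (placeOf 3).adicCompletionIntegers ℚ)) =
      uO ^ 12 * (((-8 : ℤ) : (placeOf 3).adicCompletionIntegers ℚ) * β₄ ^ 3 -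
        ((3 : ℤ) : (placeOf 3).adicCompletionIntegers ℚ) * β₆ ^ 2 +
        ((9 : ℤ) : (placeOf 3).adicCompletionIntegers ℚ) * tO) := by
    have c8 : ((8 : (placeOf 3).adicCompletionIntegers ℚ) : (placeOf 3).adicCompletion ℚ) = 8 :=
      map_ofNat ((placeOf 3).adicCompletionIntegers ℚ).subtype 8
    have c3' : ((3 : (placeOf 3).adicCompletionIntegers ℚ) : (placeOf 3).adicCompletion ℚ) = 3 :=
      map_ofNat ((placeOf 3).adicCompletionIntegers ℚ).subtype 3
    have c9 : ((9 : (placeOf 3).adicCompletionIntegers ℚ) : (placeOf 3).adicCompletion ℚ) = 9 :=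
      map_ofNat ((placeOf 3).adicCompletionIntegers ℚ).subtype 9
    apply Subtype.ext
    push_cast
    rw [huO, htO, hD'eq, hδeq, c8, c3', c9]
    ring
  -- a residue map `𝒪_v →+* ℤ_3 →+* ℤ/9` (any ring hom to `ℤ/9` will do; this one exists)
  obtain ⟨φ⟩ : Nonempty ((placeOf 3).adicCompletionIntegers ℚ →+* ZMod 9) := by
    let p3 : Nat.Primes := primesEquiv (R := ℤ) (placeOf 3)
    haveI : Fact (Nat.Prime (p3 : ℕ)) := ⟨p3.2⟩
    have hp3 : (p3 : ℕ) = 3 :=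
      congrArg Subtype.val ((primesEquiv (R := ℤ)).apply_symm_apply ⟨3, Nat.prime_three⟩)
    have h9 : 9 ∣ (p3 : ℕ) ^ 2 := by rw [hp3]; norm_num
    have hbij := adicCompletion.padicEquiv_bijOn (R := ℤ) (placeOf 3)
    let ρ : (placeOf 3).adicCompletionIntegers ℚ →+* ℤ_[p3] :=
      ((adicCompletion.padicEquiv (R := ℤ) (placeOf 3)).toRingHom.comp
        ((placeOf 3).adicCompletionIntegers ℚ).subtype).codRestrict (PadicInt.subring p3)
        (fun x => hbij.mapsTo x.2)
    exact ⟨(ZMod.castHom h9 (ZMod 9)).comp ((PadicInt.toZModPow 2).comp ρ)⟩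
  have hφ := congrArg φ hO
  simp only [map_intCast, map_mul, map_pow, map_sub, map_add] at hφ
  push_cast at hφ
  rw [show (9 : ZMod 9) = 0 by decide, zero_mul, add_zero] at hφ
  -- units stay units: `x⁶ = 1` in `ℤ/9`
  have c1 : φ uO ^ 12 = 1 := by
    rw [show (12 : ℕ) = 6 * 2 from rfl, pow_mul,
      pow_six_eq_one_of_isUnit ((isUnit_of_valued_eq_one (x := uO) hwu).map φ), one_pow]
  have c2 : φ β₄ ^ 6 = 1 := pow_six_eq_one_of_isUnit ((isUnit_of_valued_eq_one (x := β₄) hβ₄).map φ)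
  have c3 : φ β₆ ^ 6 = 1 := pow_six_eq_one_of_isUnit (hβ₆.map φ)
  obtain ⟨k1, k8⟩ := zmod_nine_key (φ β₄) (φ β₆) c2 c3
  rw [c1, one_mul] at hφ
  rw [isPmOneModNine_iff_zmod, hφ]
  rintro (h | h)
  · exact k1 h
  · exact k8 h

/-- **L-O6-cyc9 `CondExpFourUnitPartLawThree` HOLDS** (cc-typer-5's TARGET in
`Additive/LocIrrThreeCriteria.lean`, binders verbatim) — the Table II binder of
`condExpFourUnitPartLawThree_of_tableII` retired. CENSUS 1 833 / 1 833 stays EVIDENCE; nothing booked;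
no mark. [cite: SilvermanATAEC1994, IV.9.4 Steps 5, 10 and Table 4.1] -/
theorem condExpFourUnitPartLawThree_holds : CondExpFourUnitPartLawThree :=
  fun W _ _ hadd hf hv => not_isPmOneModNine_of_condExp_four W hadd hf hv

/-- **The cyclic wild rows never meet the Fouquet–Wan locus — UNCONDITIONALLY**: for `W` additive at
`3` with `f₃ = 4` and `v₃(Δ_min) ∈ {4, 6, 10, 12}`, `¬ LocIrr W 3` (cc-typer-5's
`not_locIrr_three_of_cyclic_values` with both TARGETS supplied as theorems:
`locIrrThreeTameCube_holds`, `condExpFourUnitPartLawThree_holds`). [folklore] -/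
theorem not_locIrr_three_of_cyclic_values' (hadd : Addv W 3) (hf : condExp W 3 = 4)
    (hv : padicValInt 3 W.minimalDiscriminantInt = 4 ∨ padicValInt 3 W.minimalDiscriminantInt = 6 ∨
      padicValInt 3 W.minimalDiscriminantInt = 10 ∨ padicValInt 3 W.minimalDiscriminantInt = 12) :
    ¬ LocIrr W 3 :=
  not_locIrr_three_of_cyclic_values W locIrrThreeTameCube_holds condExpFourUnitPartLawThree_holds
    hadd hf hv

end Curves

end Summit.BirchSwinnertonDyer.Rank1Residual.Additive

end
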